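import Literature.Geometry.Kaehler.ComplexTorusNonSimpleAbelianFourfoldConditionD
import Literature.Geometry.Kaehler.ComplexTorusSimpleCMSurfacesProductHodgeGroup
import Literature.Geometry.Kaehler.ComplexTorusSimpleCenterFieldImaginaryQuadraticEmbedding
import Literature.Geometry.Kaehler.ComplexTorusSimpleAbelianThreefoldFourCases
import Literature.Geometry.Kaehler.ComplexTorusStablyNondegenerateIffNoTypeIIIAndHodgeEqLefschetz
import Literature.Geometry.Kaehler.ComplexTorusHomRankEquality
import Literature.Geometry.Kaehler.ComplexTorusProductHomRank
import HarnessLib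

/-!
# Moonen–Zarhin 1999 Thm. (0.1) (4) for NON-SIMPLE complex abelian fourfolds, in one statement: a polarised
# abelian fourfold which is not simple and not in case (a) satisfies condition (D) — `ℬ•(Xⁿ) = 𝒟•(Xⁿ)` for all
# `n` — and `Hg(X) = Sp_D(V,φ)`; equivalently, a non-simple fourfold NOT satisfying (D) is in case (a)

[topic Geometry/Kaehler]

Layer `Literature/Geometry/Kaehler`, namespace `Literature.Geometry.Kaehler.ComplexTorus`; lane `lit-hodgefound` (Track 2
foundations library), Layer A4 (cycle classes on abelian varieties: known cases of `𝒟 = ℬ`); prover seat `lit-hodgefound-p17`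
(generation 54), self-proposed row g54-#1 — the ASSEMBLY of the non-simple-fourfold half of Thm. (0.1) (4) from the pieces
the tree holds separately: the Poincaré split of a non-simple polarised fourfold (`X ∼ T × E_τ` with `T` a polarised
threefold, or `X ∼ Y₁ × Y₂` with `Y₁, Y₂` polarised surfaces: `ComplexTorusNonSimpleAbelianFourfoldConditionD` §3), (D) for
`X ∼ T × E_τ` outside case (a) (ibid. §4, g51), (D) for EVERY `X ∼ Y₁ × Y₂` (g53-#3
`ComplexTorusSimpleCMSurfacesProductHodgeGroup` §3: Prop. (4.2) closed the CM × CM case), «an embedding `k ↪ End⁰(X₂)`» read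
literally (g51-#10 `ComplexTorusSimpleCenterFieldImaginaryQuadraticEmbedding`, with `End⁰(X₂) = F` for a simple threefold,
`ComplexTorusSimpleAbelianThreefoldFourCases` §1), and Gordon's Thm. 7.5 (1) ⟺ (2) (`ComplexTorusStablyNondegenerateIff…`,
A4-103) for «`Hg(X) = Sp_D(V,φ)`».  THEOREMS ONLY (no definition, no instance, no notation, no named fact; D-0026, net debt 0).
Everything is consumed BY NAME; nothing is restated.

## Sources, VERBATIM (held `paper:arxiv-math_9901113`)

* B. J. J. Moonen, Yu. G. Zarhin [MoonenZarhin1999LowDim], *Hodge classes on abelian varieties of low dimension*, Math. Ann.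
  **315** (1999) 711–733.  Introduction, case (a) (p0001 L77–L80): «(a) The abelian variety `X` is isogenous to a product
  `X₁ × X₂` where `X₁` is an elliptic curve with complex multiplication by an imaginary quadratic field `k` and where `X₂` is a
  simple abelian threefold such that there exists an embedding `k ↪ End⁰(X₂)`.»; cases (b)–(d) (p0001 L82–L93) all begin «The
  abelian variety `X` is simple of dimension 4 …».  Thm. (0.1) (p0001 L96–L122): «Let `X` be a complex abelian variety with
  `dim(X) ≤ 4`. Write `V = H₁(X(ℂ),ℚ)` and let `φ : V × V → ℚ` be the Riemann form associated to a polarization of `X`. Write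
  `D = End⁰(X)` and let `Sp_D(V,φ)` denote the centralizer of `D` inside the symplectic group `Sp(V,φ)`. … (4) Suppose we are
  not in one of the cases (a), (b), (c) or (d). Then `Hg(X) = Sp_D(V,φ)` and `ℬ•(Xⁿ) = 𝒟•(Xⁿ)` for all `n`.»; p0001 L123–L125:
  «Let us note that in the cases (a), (b) and (c) the Weil classes are really needed to generate the Hodge ring; in these
  cases we have `𝒟²(X) ≠ ℬ²(X)`.»  §5 (5.4) (p0009 L83–L95): «Let `X` be a non-simple complex abelian fourfold. … We can write
  `X ∼ X₁ × X₂ʳ` with `r ≥ 1` and `Hom(X₂,X₁) = 0`. Suppose that we are not in case (a). … If `dim(X₂) = 3` then `X₁` is an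
  elliptic curve and we can apply (3.8), which works since we are not in case (a). If `dim(X₂) < 3` then the desired equality
  `Hg(X) = Hg(X₁) × Hg(X₂)` follows from (3.2) and (3.8).»; (5.5) (p0009 L97–L108): «… If we are not in case (a) then there is
  no embedding of `End⁰(X₁)` into the center of `End⁰(X₂)`. … This only leaves us with the case where `X ∼ X₁ × X₂`, with `X₁`
  and `X₂` simple abelian surfaces. If `X₁` and `X₂` are isogenous then we are done. If `X₁` and `X₂` are not isogenous then
  Proposition (4.2) shows that `Hg(X) = Hg(X₁) × Hg(X₂)`. This completes the proof of Theorem (0.1).»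
* B. B. Gordon [Gordon1999HodgeAVSurvey], *A survey of the Hodge conjecture for abelian varieties*, Thm. 7.5 (1) ⟺ (2)
  («`Hdg(Aᵏ) = Div(Aᵏ)` for all `k ≥ 1` ⟺ `A` has no factor of type (III), and `Hg(A) = Lf(A)`»), Def. 7.6.
* H. Lange [Lange2023AbelianVarietiesComplex], *Abelian Varieties over the Complex Numbers* (2023), §2.4.4 Thm. 2.4.25
  (Poincaré's complete reducibility), Cor. 2.4.26, §1.1.2 Cor. 1.1.16 (isogeny), §5.1.5 Exercise (1) (`End_ℚ(E_τ) = ℚ(τ)` for a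
  curve with complex multiplication).

## Reading of case (a) (recorded)

For a polarised complex torus `X = E/Ψ(ℤ^κ)` of dimension `4`, «case (a)» is read as: there exist a polarised complex torus
`T = E'/Ψ'(ℤ^{κ'})` of dimension `3` which is simple, and `τ ∈ ℂ ∖ ℝ` such that `E_τ = ℂ/(ℤ + ℤτ)` has complex
multiplication (`ellipticEnd hτ ≠ ⊥`, i.e. `End_ℚ(E_τ) = ℚ(τ) = k` imaginary quadratic), with `X ∼ T × E_τ` and an embedding
`k = ℚ[τ] ↪ End⁰(T)` (a `ℚ`-algebra map `Algebra.adjoin ℚ {τ} →ₐ[ℚ] endAlgRat Ψ'`; for a simple threefold `End⁰(T) = F` is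
its own centre, a number field, and such a map exists iff some complex embedding of `F` takes the value `τ`, g51-#10).  The
order of the factors (`T × E_τ` rather than `X₁ × X₂ = E × T`) follows the tree's files; `prodPeriod` is commutative up to
isomorphism (`isIsomorphic_prodPeriod_comm`).  «Not in case (a)» is the negation, quantified over ALL such `(T, τ)` — the
hypothesis `ha` of the theorems of §2–§4 (three equivalent spellings: no `ℚ[τ] →ₐ End⁰(T)`; no `ℚ[τ] →ₐ F`; no complex
embedding `φ` of `F` with `φ(c) = τ` — the last being the form consumed by the tree's `T × E_τ` files).

## Contents

* §1 two bridges: `IsIsogenous.homRat_ne_bot_of_prod_right ∕ _left` (`X ∼ X₁ × X₂ ⟹ Hom_ℚ(X₂, X) ≠ 0`, `Hom_ℚ(X₁, X) ≠ 0`);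
  **`IsSimple.nonempty_algHom_endAlgRat_iff_nonempty_algHom_centerField_of_finrank_eq_three`** («`k ↪ End⁰(X₂)`» ⟺ «`k ↪ F`»
  for a simple threefold, `End⁰(X₂) = F`).
* §2 **`IsRiemannForm.exists_isIsogenous_subtorusPeriod_prod_ellipticPeriod_of_exists_divisorClasses_powPeriod_ne_of_not_isSimple_of_finrank_eq_four`**
  — A NON-SIMPLE POLARISED FOURFOLD WHICH DOES NOT SATISFY (D) IS IN CASE (a), with witnesses: a simple polarised abelian
  sub-threefold `T = π(V) ⊆ X` (a Poincaré subtorus), a CM curve `E_τ` with `X ∼ T × E_τ`, and an embedding `ℚ[τ] ↪ End⁰(T)`;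
  `IsRiemannForm.isSimple_or_exists_…_of_finrank_eq_four` (every fourfold failing (D) is simple or in case (a)); and THM. (0.1)
  (4) FOR NON-SIMPLE FOURFOLDS: **`IsRiemannForm.forall_divisorClasses_powPeriod_eq_hodgeClasses_of_not_isSimple_of_finrank_eq_four`**
  (not in case (a) ⟹ `ℬ•(Xⁿ) = 𝒟•(Xⁿ)` for all `n`), with the variants `…_of_forall_isEmpty_algHom_centerField`,
  `…_of_forall_apply_ne` (the tree's working form), `…_of_forall_homRat_ellipticPeriod_eq_bot` (no CM elliptic curve maps
  non-trivially to `X`), and the `IsAbelianVariety` ∕ `IsIsogenous` forms.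
* §3 «`Hg(X) = Sp_D(V,φ)`» for non-simple fourfolds outside case (a): `IsRiemannForm.hodgeGroup_eq_lefschetzGroup_of_not_isSimple_of_finrank_eq_four`
  (real points, Milne's full centraliser `S(X)(ℝ)`), `…hodgeGroupC_eq_lefschetzGroupC…` (complex points), `…hodgeGroup_eq_lefschetzIdentity…`
  (Lange's connected `Lf(X)(ℝ)`).
* §4 dimension `≤ 4` uniformly: **`IsRiemannForm.forall_divisorClasses_powPeriod_eq_hodgeClasses_of_finrank_le_four`** — every
  polarised complex abelian variety of dimension `≤ 4` which is not simple of dimension `4` and not in case (a) satisfies (D)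
  (the simple fourfolds — cases (b), (c), (d) and [MZ95] — are not treated here).
-/

noncomputable section

open Module Matrix NumberField

namespace Literature.Geometry.Kaehler

namespace ComplexTorus

/-! ## §1 Two bridges: isogeny factors have non-zero `Hom`; «`k ↪ End⁰(X₂)`» ⟺ «`k ↪ F`» for a simple threefold -/

section HomFactor

variable {ι ι₁ ι₂ : Type*} [Fintype ι] [Fintype ι₁] [Fintype ι₂] [DecidableEq ι] [DecidableEq ι₁] [DecidableEq ι₂]
  {F F₁ F₂ : Type*} [NormedAddCommGroup F] [NormedSpace ℂ F] [NormedAddCommGroup F₁] [NormedSpace ℂ F₁]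
  [NormedAddCommGroup F₂] [NormedSpace ℂ F₂] {Φ : (ι → ℝ) ≃L[ℝ] F} {Φ₁ : (ι₁ → ℝ) ≃L[ℝ] F₁} {Φ₂ : (ι₂ → ℝ) ≃L[ℝ] F₂}

/-- **An isogeny factor maps non-trivially to `X`: `X ∼ X₁ × X₂ ⟹ Hom_ℚ(X₂, X) ≠ 0`** (`dim Hom_ℚ(X₂, X) = dim Hom_ℚ(X₂, X₁ × X₂)
= dim Hom_ℚ(X₂, X₁) + dim End_ℚ(X₂) ≥ 1`: `Hom_ℚ` only depends on the isogeny classes, Cor. 1.1.16, and `Hom(Y, X₁ × X₂) =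
Hom(Y, X₁) ⊕ Hom(Y, X₂)`, Cor. 2.4.26). [cite: Lange2023AbelianVarietiesComplex, §1.1.2 Cor. 1.1.16 and §2.4.4 Cor. 2.4.26 (proof, p. 124)] -/
theorem IsIsogenous.homRat_ne_bot_of_prod_right [Nonempty ι₂] (h : IsIsogenous Φ (prodPeriod Φ₁ Φ₂)) : homRat Φ₂ Φ ≠ ⊥ := by
  rw [Ne, ← Submodule.finrank_eq_zero, IsIsogenous.finrank_homRat_eq_right Φ₂ h, finrank_homRat_prod_right,
    finrank_homRat_self]
  have h1 := one_le_finrank_endAlgRat Φ₂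
  omega

/-- **`X ∼ X₁ × X₂ ⟹ Hom_ℚ(X₁, X) ≠ 0`.** [cite: Lange2023AbelianVarietiesComplex, §1.1.2 Cor. 1.1.16 and §2.4.4 Cor. 2.4.26 (proof, p. 124)] -/
theorem IsIsogenous.homRat_ne_bot_of_prod_left [Nonempty ι₁] (h : IsIsogenous Φ (prodPeriod Φ₁ Φ₂)) : homRat Φ₁ Φ ≠ ⊥ := by
  rw [Ne, ← Submodule.finrank_eq_zero, IsIsogenous.finrank_homRat_eq_right Φ₁ h, finrank_homRat_prod_right,
    finrank_homRat_self]
  have h1 := one_le_finrank_endAlgRat Φ₁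
  omega

end HomFactor

section EndCentre

variable {κ : Type} [Fintype κ] [DecidableEq κ] [Nonempty κ] {E : Type} [NormedAddCommGroup E] [NormedSpace ℂ E]
  [FiniteDimensional ℂ E] {Ψ : (κ → ℝ) ≃L[ℝ] E}

/-- **«AN EMBEDDING `k ↪ End⁰(X₂)`» ⟺ «AN EMBEDDING `k ↪ F`» FOR A SIMPLE COMPLEX ABELIAN THREEFOLD `X₂`** — `End⁰(X₂) = F` is
its own centre (a number field: `ℚ`, a totally real cubic, an imaginary quadratic or a sextic CM field; the tree's
`IsSimple.range_valAlgHom_eq_endAlgRat_of_finrank_eq_three`), so for any `ℚ`-algebra `A` there is a `ℚ`-algebra map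
`A → End_ℚ(X₂)` iff there is one `A → F = centerField`. [cite: MoonenZarhin1999LowDim, Introduction, case (a) (p0001 L77–L80) and §2 (2.3) `g = 3` (p0005 L83–L106: «`End⁰(X) = F`»)]
[cite: Lange2023AbelianVarietiesComplex, §2.6.1 Proposition (`d = 1` at `g = 3`)] -/
theorem IsSimple.nonempty_algHom_endAlgRat_iff_nonempty_algHom_centerField_of_finrank_eq_three (hX : IsSimple Ψ)
    (h3 : finrank ℂ E = 3) (A : Type*) [Semiring A] [Algebra ℚ A] :
    Nonempty (A →ₐ[ℚ] endAlgRat Ψ) ↔ Nonempty (A →ₐ[ℚ] centerField Ψ hX) := by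
  have hinj : Function.Injective (centerField.valAlgHom Ψ hX) := fun a b hab ↦ centerField.val_injective Ψ hX hab
  let e : centerField Ψ hX ≃ₐ[ℚ] endAlgRat Ψ :=
    (AlgEquiv.ofInjective _ hinj).trans (Subalgebra.equivOfEq _ _ (hX.range_valAlgHom_eq_endAlgRat_of_finrank_eq_three h3))
  exact ⟨fun ⟨f⟩ ↦ ⟨(e.symm : endAlgRat Ψ →ₐ[ℚ] centerField Ψ hX).comp f⟩,
    fun ⟨g⟩ ↦ ⟨(e : centerField Ψ hX →ₐ[ℚ] endAlgRat Ψ).comp g⟩⟩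

/-- **«NO EMBEDDING `ℚ[τ] ↪ End⁰(X₂)`» (`X₂` a simple threefold, `E_τ` with complex multiplication) gives the tree's working
form «no complex embedding `φ` of the centre `F` has `φ(c) = τ`»** (§1 + g51-#10 `IsSimple.isEmpty_algHom_adjoin_centerField_iff`).
[cite: MoonenZarhin1999LowDim, Introduction, case (a) (p0001 L77–L80) and §5 (5.5) (p0009 L97–L100)] -/
theorem IsSimple.forall_ringHom_centerField_apply_ne_of_isEmpty_algHom_endAlgRat_of_finrank_eq_three (hX : IsSimple Ψ)
    (h3 : finrank ℂ E = 3) {τ : ℂ} (hτ : τ.im ≠ 0) (hCM : ellipticEnd hτ ≠ ⊥)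
    (h : IsEmpty (Algebra.adjoin ℚ {τ} →ₐ[ℚ] endAlgRat Ψ)) : ∀ φ : centerField Ψ hX →+* ℂ, ∀ c, φ c ≠ τ := by
  refine hX.forall_ringHom_centerField_apply_ne_of_isEmpty_algHom hτ hCM (not_nonempty_iff.1 fun hne ↦ ?_)
  exact not_nonempty_iff.2 h
    ((hX.nonempty_algHom_endAlgRat_iff_nonempty_algHom_centerField_of_finrank_eq_three h3 _).2 hne)

/-- Conversely **a complex embedding `φ` of `F` with `φ(c) = τ` yields an embedding `ℚ[τ] ↪ End⁰(X₂)`** (`X₂` a simple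
threefold). [cite: MoonenZarhin1999LowDim, Introduction, case (a) (p0001 L77–L80) and §3 Prop. (3.8) (p0007 L52–L56)] -/
theorem IsSimple.nonempty_algHom_adjoin_endAlgRat_of_ringHom_apply_eq_of_finrank_eq_three (hX : IsSimple Ψ)
    (h3 : finrank ℂ E = 3) (φ : centerField Ψ hX →+* ℂ) {c : centerField Ψ hX} {τ : ℂ} (hc : φ c = τ) :
    Nonempty (Algebra.adjoin ℚ {τ} →ₐ[ℚ] endAlgRat Ψ) :=
  (hX.nonempty_algHom_endAlgRat_iff_nonempty_algHom_centerField_of_finrank_eq_three h3 _).2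
    (nonempty_algHom_adjoin_of_ringHom_apply_eq φ hc)

end EndCentre

/-! ## §2 Thm. (0.1) (4) for non-simple fourfolds: failing (D) forces case (a); outside case (a), (D) holds -/

section Fourfold

variable {κ : Type} [Fintype κ] [DecidableEq κ] {E : Type} [NormedAddCommGroup E] [NormedSpace ℂ E]
  [FiniteDimensional ℂ E] {Ψ : (κ → ℝ) ≃L[ℝ] E} {η : E [⋀^Fin 2]→L[ℝ] ℝ}

/-- **A NON-SIMPLE POLARISED COMPLEX ABELIAN FOURFOLD WHICH DOES NOT SATISFY CONDITION (D) IS IN CASE (a)** — with witnesses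
inside `X`: a Poincaré subtorus `T = π(V) ⊆ X` which is a SIMPLE polarised abelian threefold, and `τ ∈ ℂ ∖ ℝ` such that
`E_τ` has complex multiplication, `X ∼ T × E_τ`, and `k = ℚ[τ] = End⁰(E_τ)` embeds into `End⁰(T)` («`X` is isogenous to a
product `X₁ × X₂` where `X₁` is an elliptic curve with complex multiplication by an imaginary quadratic field `k` and where
`X₂` is a simple abelian threefold such that there exists an embedding `k ↪ End⁰(X₂)`»).  PROOF: `X ∼ T × E_τ` or
`X ∼ Y₁ × Y₂` (Poincaré); every `X ∼ Y₁ × Y₂` satisfies (D) ((5.4)–(5.5) with Prop. (4.2), the tree's g52–g53 assembly);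
`X ∼ T × E_τ` satisfies (D) unless `T` is simple, `E_τ` has complex multiplication and some complex embedding of the centre
`F = End⁰(T)` takes the value `τ` ((3.8), the tree's g51 assembly), i.e. unless `ℚ[τ] ↪ End⁰(T)` (§1).
[cite: MoonenZarhin1999LowDim, Thm. (0.1) (4) (p0001 L120–L122), Introduction, case (a) (p0001 L77–L80), §5 (5.4)–(5.5) (p0009 L83–L108)]
[cite: Lange2023AbelianVarietiesComplex, §2.4.4 Thm. 2.4.25 and Cor. 2.4.26] -/
theorem IsRiemannForm.exists_isIsogenous_subtorusPeriod_prod_ellipticPeriod_of_exists_divisorClasses_powPeriod_ne_of_not_isSimple_of_finrank_eq_four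
    (hη : IsRiemannForm Ψ η) (h4 : finrank ℂ E = 4) (hX : ¬ IsSimple Ψ)
    (h : ∃ k p, divisorClasses (powPeriod Ψ k) p ≠ hodgeClasses (powPeriod Ψ k) p) :
    ∃ (V : Submodule ℝ (κ → ℝ)) (hV : IsLatticeSubspace V) (hVc : IsComplexSubspace Ψ V) (τ : ℂ) (hτ : τ.im ≠ 0),
      finrank ℂ (cxSpan Ψ V) = 3 ∧ IsSimple (subtorusPeriod Ψ V hV hVc) ∧ ellipticEnd hτ ≠ ⊥ ∧
        IsIsogenous Ψ (prodPeriod (subtorusPeriod Ψ V hV hVc) (ellipticPeriod hτ)) ∧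
          Nonempty (Algebra.adjoin ℚ {τ} →ₐ[ℚ] endAlgRat (subtorusPeriod Ψ V hV hVc)) := by
  obtain ⟨k, p, hkp⟩ := h
  rcases hη.exists_isIsogenous_prod_of_not_isSimple_of_finrank_eq_four h4 hX with
    ⟨V, hV, hVc, τ, hτ, h3, hiso⟩ | ⟨V, hV, hVc, hW, hWc, h2, h2', hiso⟩
  · -- `X ∼ T × E_τ`, `T = π(V)` a polarised threefold: (D) holds unless we are in case (a)
    haveI : Nonempty (Fin (subRank V)) := ⟨⟨0, by rw [subRank_eq_two_mul_finrank Ψ hV hVc, h3]; norm_num⟩⟩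
    by_contra hne
    refine hkp (hiso.forall_divisorClasses_powPeriod_eq_hodgeClasses_of_prod_ellipticPeriod_of_finrank_eq_three_of_forall_apply_ne
      hτ (isRiemannForm_restrict Ψ hη hV hVc) h3 (fun hT hE φ c hc ↦ hne ?_) k p)
    exact ⟨V, hV, hVc, τ, hτ, h3, hT, hE, hiso,
      hT.nonempty_algHom_adjoin_endAlgRat_of_ringHom_apply_eq_of_finrank_eq_three h3 φ hc⟩
  · -- `X ∼ Y₁ × Y₂`, two polarised abelian surfaces: (D) always holds
    exact absurd (hiso.forall_divisorClasses_powPeriod_eq_hodgeClasses_of_prod_of_finrank_eq_two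
      (isRiemannForm_restrict Ψ hη hV hVc) (isRiemannForm_restrict Ψ hη hW hWc) h2 h2' k p) hkp

/-- **A POLARISED COMPLEX ABELIAN FOURFOLD WHICH DOES NOT SATISFY (D) IS SIMPLE OR IN CASE (a)** (the dimension-`4` content of
«(4) Suppose we are not in one of the cases (a), (b), (c) or (d). Then … `ℬ•(Xⁿ) = 𝒟•(Xⁿ)` for all `n`»: cases (b), (c), (d)
are simple fourfolds). [cite: MoonenZarhin1999LowDim, Thm. (0.1) (4) (p0001 L120–L122) and Introduction, cases (a)–(d) (p0001 L77–L93)] -/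
theorem IsRiemannForm.isSimple_or_exists_isIsogenous_subtorusPeriod_prod_ellipticPeriod_of_exists_divisorClasses_powPeriod_ne_of_finrank_eq_four
    (hη : IsRiemannForm Ψ η) (h4 : finrank ℂ E = 4)
    (h : ∃ k p, divisorClasses (powPeriod Ψ k) p ≠ hodgeClasses (powPeriod Ψ k) p) :
    IsSimple Ψ ∨
      ∃ (V : Submodule ℝ (κ → ℝ)) (hV : IsLatticeSubspace V) (hVc : IsComplexSubspace Ψ V) (τ : ℂ) (hτ : τ.im ≠ 0),
        finrank ℂ (cxSpan Ψ V) = 3 ∧ IsSimple (subtorusPeriod Ψ V hV hVc) ∧ ellipticEnd hτ ≠ ⊥ ∧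
          IsIsogenous Ψ (prodPeriod (subtorusPeriod Ψ V hV hVc) (ellipticPeriod hτ)) ∧
            Nonempty (Algebra.adjoin ℚ {τ} →ₐ[ℚ] endAlgRat (subtorusPeriod Ψ V hV hVc)) :=
  (em (IsSimple Ψ)).imp_right fun hX ↦
    hη.exists_isIsogenous_subtorusPeriod_prod_ellipticPeriod_of_exists_divisorClasses_powPeriod_ne_of_not_isSimple_of_finrank_eq_four
      h4 hX h

/-- **MOONEN–ZARHIN THM. (0.1) (4) FOR NON-SIMPLE FOURFOLDS: A POLARISED COMPLEX ABELIAN FOURFOLD WHICH IS NOT SIMPLE AND NOT IN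
CASE (a) SATISFIES CONDITION (D)** — `ℬᵖ(Xᵏ) = 𝒟ᵖ(Xᵏ)` for all `k, p`: on every power of `X` every Hodge class is a polynomial
in divisor classes (so the Hodge conjecture holds for all `Xᵏ`).  «Not in case (a)» (hypothesis `ha`): for every simple
polarised complex abelian threefold `T` and every `E_τ` with complex multiplication such that `X ∼ T × E_τ`, there is NO
embedding `ℚ[τ] = End⁰(E_τ) ↪ End⁰(T)`. [cite: MoonenZarhin1999LowDim, Thm. (0.1) (4) (p0001 L120–L122), Introduction, case (a) (p0001 L77–L80), §5 (5.4)–(5.5) (p0009 L83–L108)]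
[cite: Lange2023AbelianVarietiesComplex, §2.4.4 Thm. 2.4.25 and §5.1.5 Exercise (1)] -/
theorem IsRiemannForm.forall_divisorClasses_powPeriod_eq_hodgeClasses_of_not_isSimple_of_finrank_eq_four
    (hη : IsRiemannForm Ψ η) (h4 : finrank ℂ E = 4) (hX : ¬ IsSimple Ψ)
    (ha : ∀ {κ' : Type} [Fintype κ'] [DecidableEq κ'] {E' : Type} [NormedAddCommGroup E'] [NormedSpace ℂ E']
      [FiniteDimensional ℂ E'] {Ψ' : (κ' → ℝ) ≃L[ℝ] E'} {η' : E' [⋀^Fin 2]→L[ℝ] ℝ}, IsRiemannForm Ψ' η' →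
      finrank ℂ E' = 3 → IsSimple Ψ' → ∀ {τ : ℂ} (hτ : τ.im ≠ 0), ellipticEnd hτ ≠ ⊥ →
      IsIsogenous Ψ (prodPeriod Ψ' (ellipticPeriod hτ)) → IsEmpty (Algebra.adjoin ℚ {τ} →ₐ[ℚ] endAlgRat Ψ')) :
    ∀ k p, divisorClasses (powPeriod Ψ k) p = hodgeClasses (powPeriod Ψ k) p := by
  by_contra h
  push Not at h
  obtain ⟨V, hV, hVc, τ, hτ, h3, hT, hE, hiso, hne⟩ :=
    hη.exists_isIsogenous_subtorusPeriod_prod_ellipticPeriod_of_exists_divisorClasses_powPeriod_ne_of_not_isSimple_of_finrank_eq_four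
      h4 hX h
  exact not_nonempty_iff.2 (ha (isRiemannForm_restrict Ψ hη hV hVc) h3 hT hτ hE hiso) hne

/-- **Thm. (0.1) (4) for non-simple fourfolds, «not in case (a)» on the centre**: for every simple polarised threefold `T` and
CM curve `E_τ` with `X ∼ T × E_τ`, no embedding `ℚ[τ] ↪ F` into the centre `F` of `End⁰(T)` («there is no embedding of
`End⁰(X₁)` into the center of `End⁰(X₂)`») ⟹ `X` satisfies (D). [cite: MoonenZarhin1999LowDim, Thm. (0.1) (4) (p0001 L120–L122) and §5 (5.5) (p0009 L97–L100)] -/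
theorem IsRiemannForm.forall_divisorClasses_powPeriod_eq_hodgeClasses_of_not_isSimple_of_finrank_eq_four_of_forall_isEmpty_algHom_centerField
    (hη : IsRiemannForm Ψ η) (h4 : finrank ℂ E = 4) (hX : ¬ IsSimple Ψ)
    (ha : ∀ {κ' : Type} [Fintype κ'] [DecidableEq κ'] [Nonempty κ'] {E' : Type} [NormedAddCommGroup E'] [NormedSpace ℂ E']
      [FiniteDimensional ℂ E'] {Ψ' : (κ' → ℝ) ≃L[ℝ] E'} {η' : E' [⋀^Fin 2]→L[ℝ] ℝ}, IsRiemannForm Ψ' η' →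
      finrank ℂ E' = 3 → ∀ (hT : IsSimple Ψ') {τ : ℂ} (hτ : τ.im ≠ 0), ellipticEnd hτ ≠ ⊥ →
      IsIsogenous Ψ (prodPeriod Ψ' (ellipticPeriod hτ)) → IsEmpty (Algebra.adjoin ℚ {τ} →ₐ[ℚ] centerField Ψ' hT)) :
    ∀ k p, divisorClasses (powPeriod Ψ k) p = hodgeClasses (powPeriod Ψ k) p := by
  by_contra h
  push Not at h
  obtain ⟨V, hV, hVc, τ, hτ, h3, hT, hE, hiso, hne⟩ :=
    hη.exists_isIsogenous_subtorusPeriod_prod_ellipticPeriod_of_exists_divisorClasses_powPeriod_ne_of_not_isSimple_of_finrank_eq_four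
      h4 hX h
  haveI : Nonempty (Fin (subRank V)) := ⟨⟨0, by rw [subRank_eq_two_mul_finrank Ψ hV hVc, h3]; norm_num⟩⟩
  exact not_nonempty_iff.2 (ha (isRiemannForm_restrict Ψ hη hV hVc) h3 hT hτ hE hiso)
    ((hT.nonempty_algHom_endAlgRat_iff_nonempty_algHom_centerField_of_finrank_eq_three h3 _).1 hne)

/-- **Thm. (0.1) (4) for non-simple fourfolds, in the tree's working form**: for every simple polarised threefold `T` and CM
curve `E_τ` with `X ∼ T × E_τ`, no complex embedding `φ` of the centre `F` of `End⁰(T)` takes the value `τ` ⟹ `X` satisfies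
(D) (the hypothesis shape of `ComplexTorusNonSimpleAbelianFourfoldConditionD` §4 and `ComplexTorusAbelianThreefoldTimesEllipticCurve`).
[cite: MoonenZarhin1999LowDim, Thm. (0.1) (4) (p0001 L120–L122), §3 Prop. (3.8) (p0007 L52–L74) and §5 (5.4)–(5.5) (p0009 L83–L108)] -/
theorem IsRiemannForm.forall_divisorClasses_powPeriod_eq_hodgeClasses_of_not_isSimple_of_finrank_eq_four_of_forall_apply_ne
    (hη : IsRiemannForm Ψ η) (h4 : finrank ℂ E = 4) (hX : ¬ IsSimple Ψ)
    (ha : ∀ {κ' : Type} [Fintype κ'] [DecidableEq κ'] [Nonempty κ'] {E' : Type} [NormedAddCommGroup E'] [NormedSpace ℂ E']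
      [FiniteDimensional ℂ E'] {Ψ' : (κ' → ℝ) ≃L[ℝ] E'} {η' : E' [⋀^Fin 2]→L[ℝ] ℝ}, IsRiemannForm Ψ' η' →
      finrank ℂ E' = 3 → ∀ (hT : IsSimple Ψ') {τ : ℂ} (hτ : τ.im ≠ 0), ellipticEnd hτ ≠ ⊥ →
      IsIsogenous Ψ (prodPeriod Ψ' (ellipticPeriod hτ)) → ∀ φ : centerField Ψ' hT →+* ℂ, ∀ c, φ c ≠ τ) :
    ∀ k p, divisorClasses (powPeriod Ψ k) p = hodgeClasses (powPeriod Ψ k) p := by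
  by_contra h
  push Not at h
  obtain ⟨V, hV, hVc, τ, hτ, h3, hT, hE, hiso, hne⟩ :=
    hη.exists_isIsogenous_subtorusPeriod_prod_ellipticPeriod_of_exists_divisorClasses_powPeriod_ne_of_not_isSimple_of_finrank_eq_four
      h4 hX h
  haveI : Nonempty (Fin (subRank V)) := ⟨⟨0, by rw [subRank_eq_two_mul_finrank Ψ hV hVc, h3]; norm_num⟩⟩
  exact not_nonempty_iff.2 ((hT.isEmpty_algHom_adjoin_centerField_iff hτ hE).2
      (ha (isRiemannForm_restrict Ψ hη hV hVc) h3 hT hτ hE hiso))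
    ((hT.nonempty_algHom_endAlgRat_iff_nonempty_algHom_centerField_of_finrank_eq_three h3 _).1 hne)

/-- **A NON-SIMPLE POLARISED FOURFOLD TO WHICH NO ELLIPTIC CURVE WITH COMPLEX MULTIPLICATION MAPS NON-TRIVIALLY SATISFIES (D)**:
if `Hom_ℚ(E_τ, X) = 0` for every CM curve `E_τ`, then `X` is not in case (a) (an isogeny factor `E_τ` of `X ∼ T × E_τ` has
`Hom_ℚ(E_τ, X) ≠ 0`, §1), so `ℬ•(Xⁿ) = 𝒟•(Xⁿ)` for all `n`. [cite: MoonenZarhin1999LowDim, Thm. (0.1) (4) (p0001 L120–L122) and Introduction, case (a) (p0001 L77–L80)]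
[cite: Lange2023AbelianVarietiesComplex, §2.4.4 Cor. 2.4.26 and §1.1.2 Cor. 1.1.16] -/
theorem IsRiemannForm.forall_divisorClasses_powPeriod_eq_hodgeClasses_of_not_isSimple_of_finrank_eq_four_of_forall_homRat_ellipticPeriod_eq_bot
    (hη : IsRiemannForm Ψ η) (h4 : finrank ℂ E = 4) (hX : ¬ IsSimple Ψ)
    (hCM : ∀ (τ : ℂ) (hτ : τ.im ≠ 0), ellipticEnd hτ ≠ ⊥ → homRat (ellipticPeriod hτ) Ψ = ⊥) :
    ∀ k p, divisorClasses (powPeriod Ψ k) p = hodgeClasses (powPeriod Ψ k) p :=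
  hη.forall_divisorClasses_powPeriod_eq_hodgeClasses_of_not_isSimple_of_finrank_eq_four h4 hX
    fun _ _ _ _ hτ hE hiso ↦ absurd (hCM _ hτ hE) hiso.homRat_ne_bot_of_prod_right

/-- `IsAbelianVariety` form of **Thm. (0.1) (4) for non-simple fourfolds**: a complex abelian fourfold which is not simple and
not in case (a) satisfies (D). [cite: MoonenZarhin1999LowDim, Thm. (0.1) (4) (p0001 L120–L122) and Introduction, case (a) (p0001 L77–L80)] -/
theorem IsAbelianVariety.forall_divisorClasses_powPeriod_eq_hodgeClasses_of_not_isSimple_of_finrank_eq_four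
    (hA : IsAbelianVariety Ψ) (h4 : finrank ℂ E = 4) (hX : ¬ IsSimple Ψ)
    (ha : ∀ {κ' : Type} [Fintype κ'] [DecidableEq κ'] {E' : Type} [NormedAddCommGroup E'] [NormedSpace ℂ E']
      [FiniteDimensional ℂ E'] {Ψ' : (κ' → ℝ) ≃L[ℝ] E'} {η' : E' [⋀^Fin 2]→L[ℝ] ℝ}, IsRiemannForm Ψ' η' →
      finrank ℂ E' = 3 → IsSimple Ψ' → ∀ {τ : ℂ} (hτ : τ.im ≠ 0), ellipticEnd hτ ≠ ⊥ →
      IsIsogenous Ψ (prodPeriod Ψ' (ellipticPeriod hτ)) → IsEmpty (Algebra.adjoin ℚ {τ} →ₐ[ℚ] endAlgRat Ψ')) :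
    ∀ k p, divisorClasses (powPeriod Ψ k) p = hodgeClasses (powPeriod Ψ k) p := by
  obtain ⟨η, hη⟩ := hA
  exact hη.forall_divisorClasses_powPeriod_eq_hodgeClasses_of_not_isSimple_of_finrank_eq_four h4 hX ha

end Fourfold

section IsogenousFourfold

variable {ι : Type*} [Fintype ι] [DecidableEq ι] {F : Type*} [NormedAddCommGroup F] [NormedSpace ℂ F]
  {Φ : (ι → ℝ) ≃L[ℝ] F}
  {κ : Type} [Fintype κ] [DecidableEq κ] {E : Type} [NormedAddCommGroup E] [NormedSpace ℂ E]
  [FiniteDimensional ℂ E] {Ψ : (κ → ℝ) ≃L[ℝ] E} {η : E [⋀^Fin 2]→L[ℝ] ℝ}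

/-- **(D) is an isogeny invariant: every complex torus isogenous to a non-simple polarised fourfold outside case (a) satisfies
(D).** [cite: MoonenZarhin1999LowDim, Thm. (0.1) (4) (p0001 L120–L122) and §5 (5.4)–(5.5) (p0009 L83–L108)] [cite: Lange2023AbelianVarietiesComplex, §1.1.2 Cor. 1.1.16] -/
theorem IsIsogenous.forall_divisorClasses_powPeriod_eq_hodgeClasses_of_not_isSimple_of_finrank_eq_four
    (hiso : IsIsogenous Φ Ψ) (hη : IsRiemannForm Ψ η) (h4 : finrank ℂ E = 4) (hX : ¬ IsSimple Ψ)
    (ha : ∀ {κ' : Type} [Fintype κ'] [DecidableEq κ'] {E' : Type} [NormedAddCommGroup E'] [NormedSpace ℂ E']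
      [FiniteDimensional ℂ E'] {Ψ' : (κ' → ℝ) ≃L[ℝ] E'} {η' : E' [⋀^Fin 2]→L[ℝ] ℝ}, IsRiemannForm Ψ' η' →
      finrank ℂ E' = 3 → IsSimple Ψ' → ∀ {τ : ℂ} (hτ : τ.im ≠ 0), ellipticEnd hτ ≠ ⊥ →
      IsIsogenous Ψ (prodPeriod Ψ' (ellipticPeriod hτ)) → IsEmpty (Algebra.adjoin ℚ {τ} →ₐ[ℚ] endAlgRat Ψ')) :
    ∀ k p, divisorClasses (powPeriod Φ k) p = hodgeClasses (powPeriod Φ k) p :=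
  hiso.forall_powPeriod_divisorClasses_eq_hodgeClasses_iff.2
    (hη.forall_divisorClasses_powPeriod_eq_hodgeClasses_of_not_isSimple_of_finrank_eq_four h4 hX ha)

end IsogenousFourfold

/-! ## §3 «`Hg(X) = Sp_D(V,φ)`» for non-simple fourfolds outside case (a) -/

section HodgeEqLefschetz

variable {κ : Type} [Fintype κ] [DecidableEq κ] {E : Type} [NormedAddCommGroup E] [NormedSpace ℂ E]
  [FiniteDimensional ℂ E] {Ψ : (κ → ℝ) ≃L[ℝ] E} {η : E [⋀^Fin 2]→L[ℝ] ℝ} {G : Matrix κ κ ℚ}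

/-- **«`Hg(X) = Sp_D(V,φ)`» FOR A NON-SIMPLE POLARISED FOURFOLD OUTSIDE CASE (a), real points: `Hg(X)(ℝ) = S(X)(ℝ)`** — the
Hodge group is the full centraliser of `D = End⁰(X)` in the symplectic group of the polarisation (from (D) by Gordon's Thm.
7.5 (1) ⟹ (2), the tree's A4-103). [cite: MoonenZarhin1999LowDim, Thm. (0.1) (4) (p0001 L120–L122: «Then `Hg(X) = Sp_D(V,φ)`»)] [cite: Gordon1999HodgeAVSurvey, Thm. 7.5 (1) ⟺ (2)]
[cite: Milne1999LefschetzClasses, §4 Prop. 4.8 (a) ⟺ (c)] -/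
theorem IsRiemannForm.hodgeGroup_eq_lefschetzGroup_of_not_isSimple_of_finrank_eq_four
    (hη : IsRiemannForm Ψ η) (h4 : finrank ℂ E = 4) (hX : ¬ IsSimple Ψ)
    (ha : ∀ {κ' : Type} [Fintype κ'] [DecidableEq κ'] {E' : Type} [NormedAddCommGroup E'] [NormedSpace ℂ E']
      [FiniteDimensional ℂ E'] {Ψ' : (κ' → ℝ) ≃L[ℝ] E'} {η' : E' [⋀^Fin 2]→L[ℝ] ℝ}, IsRiemannForm Ψ' η' →
      finrank ℂ E' = 3 → IsSimple Ψ' → ∀ {τ : ℂ} (hτ : τ.im ≠ 0), ellipticEnd hτ ≠ ⊥ →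
      IsIsogenous Ψ (prodPeriod Ψ' (ellipticPeriod hτ)) → IsEmpty (Algebra.adjoin ℚ {τ} →ₐ[ℚ] endAlgRat Ψ')) :
    hodgeGroup Ψ = lefschetzGroup Ψ η := by
  obtain ⟨G, hG⟩ := hη.exists_ratMatrix_latticeGram
  exact ((hη.forall_divisorClasses_powPeriod_eq_hodgeClasses_iff_eq_and_hodgeGroup_eq_lefschetzGroup hG (by omega)).1
    (hη.forall_divisorClasses_powPeriod_eq_hodgeClasses_of_not_isSimple_of_finrank_eq_four h4 hX ha)).2

/-- **… complex points: `Hg(X)(ℂ) = S(X)(ℂ)`** (`G` any rational Gram matrix of the polarisation; `S(X)(ℂ)` is then connected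
and equal to `Lf(X)(ℂ)`). [cite: MoonenZarhin1999LowDim, Thm. (0.1) (4) (p0001 L120–L122)] [cite: Gordon1999HodgeAVSurvey, Thm. 7.5 (1) ⟺ (2) and Def. 2.14] -/
theorem IsRiemannForm.hodgeGroupC_eq_lefschetzGroupC_of_not_isSimple_of_finrank_eq_four
    (hη : IsRiemannForm Ψ η) (hG : G.map (Rat.cast : ℚ → ℝ) = latticeGram Ψ η) (h4 : finrank ℂ E = 4) (hX : ¬ IsSimple Ψ)
    (ha : ∀ {κ' : Type} [Fintype κ'] [DecidableEq κ'] {E' : Type} [NormedAddCommGroup E'] [NormedSpace ℂ E']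
      [FiniteDimensional ℂ E'] {Ψ' : (κ' → ℝ) ≃L[ℝ] E'} {η' : E' [⋀^Fin 2]→L[ℝ] ℝ}, IsRiemannForm Ψ' η' →
      finrank ℂ E' = 3 → IsSimple Ψ' → ∀ {τ : ℂ} (hτ : τ.im ≠ 0), ellipticEnd hτ ≠ ⊥ →
      IsIsogenous Ψ (prodPeriod Ψ' (ellipticPeriod hτ)) → IsEmpty (Algebra.adjoin ℚ {τ} →ₐ[ℚ] endAlgRat Ψ')) :
    hodgeGroupC Ψ = lefschetzGroupC Ψ G := by
  have h := (hη.forall_divisorClasses_powPeriod_eq_hodgeClasses_iff_eq_and_hodgeGroupC_eq_lefschetzIdentityC hG (by omega)).1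
    (hη.forall_divisorClasses_powPeriod_eq_hodgeClasses_of_not_isSimple_of_finrank_eq_four h4 hX ha)
  exact h.2.trans h.1

/-- **… Lange's connected Lefschetz group, real points: `Hg(X)(ℝ) = Lf(X)(ℝ)`** («`A` has no factor of type (III), and
`Hg(A) = Lf(A)`»). [cite: Gordon1999HodgeAVSurvey, Thm. 7.5 (1) ⟺ (2), Def. 2.14 and Def. 7.6] [cite: MoonenZarhin1999LowDim, Thm. (0.1) (4) (p0001 L120–L122)] -/
theorem IsRiemannForm.hodgeGroup_eq_lefschetzIdentity_of_not_isSimple_of_finrank_eq_four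
    (hη : IsRiemannForm Ψ η) (hG : G.map (Rat.cast : ℚ → ℝ) = latticeGram Ψ η) (h4 : finrank ℂ E = 4) (hX : ¬ IsSimple Ψ)
    (ha : ∀ {κ' : Type} [Fintype κ'] [DecidableEq κ'] {E' : Type} [NormedAddCommGroup E'] [NormedSpace ℂ E']
      [FiniteDimensional ℂ E'] {Ψ' : (κ' → ℝ) ≃L[ℝ] E'} {η' : E' [⋀^Fin 2]→L[ℝ] ℝ}, IsRiemannForm Ψ' η' →
      finrank ℂ E' = 3 → IsSimple Ψ' → ∀ {τ : ℂ} (hτ : τ.im ≠ 0), ellipticEnd hτ ≠ ⊥ →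
      IsIsogenous Ψ (prodPeriod Ψ' (ellipticPeriod hτ)) → IsEmpty (Algebra.adjoin ℚ {τ} →ₐ[ℚ] endAlgRat Ψ')) :
    hodgeGroup Ψ = lefschetzIdentity Ψ G :=
  ((hη.forall_divisorClasses_powPeriod_eq_hodgeClasses_iff_eq_and_hodgeGroup_eq_lefschetzIdentity hG (by omega)).1
    (hη.forall_divisorClasses_powPeriod_eq_hodgeClasses_of_not_isSimple_of_finrank_eq_four h4 hX ha)).2

/-- **`Hg(X)(ℝ) = S(X)(ℝ)` for a non-simple polarised fourfold to which no CM elliptic curve maps non-trivially.**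
[cite: MoonenZarhin1999LowDim, Thm. (0.1) (4) (p0001 L120–L122) and Introduction, case (a) (p0001 L77–L80)] [cite: Gordon1999HodgeAVSurvey, Thm. 7.5 (1) ⟺ (2)] -/
theorem IsRiemannForm.hodgeGroup_eq_lefschetzGroup_of_not_isSimple_of_finrank_eq_four_of_forall_homRat_ellipticPeriod_eq_bot
    (hη : IsRiemannForm Ψ η) (h4 : finrank ℂ E = 4) (hX : ¬ IsSimple Ψ)
    (hCM : ∀ (τ : ℂ) (hτ : τ.im ≠ 0), ellipticEnd hτ ≠ ⊥ → homRat (ellipticPeriod hτ) Ψ = ⊥) :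
    hodgeGroup Ψ = lefschetzGroup Ψ η := by
  obtain ⟨G, hG⟩ := hη.exists_ratMatrix_latticeGram
  exact ((hη.forall_divisorClasses_powPeriod_eq_hodgeClasses_iff_eq_and_hodgeGroup_eq_lefschetzGroup hG (by omega)).1
    (hη.forall_divisorClasses_powPeriod_eq_hodgeClasses_of_not_isSimple_of_finrank_eq_four_of_forall_homRat_ellipticPeriod_eq_bot
      h4 hX hCM)).2

end HodgeEqLefschetz

/-! ## §4 Dimension `≤ 4`, uniformly -/

section LeFour

variable {κ : Type} [Fintype κ] [DecidableEq κ] {E : Type} [NormedAddCommGroup E] [NormedSpace ℂ E]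
  [FiniteDimensional ℂ E] {Ψ : (κ → ℝ) ≃L[ℝ] E} {η : E [⋀^Fin 2]→L[ℝ] ℝ}

/-- **THM. (0.1) (4) UP TO DIMENSION `4`, OUTSIDE THE SIMPLE FOURFOLDS: every (non-zero) polarised complex abelian variety of
dimension `≤ 4` which is not simple of dimension `4` and not in case (a) satisfies condition (D)** — dimension `≤ 3`: every
`X` (the tree's `…_of_finrank_le_three`); dimension `4`, not simple: §2.  (The simple fourfolds — cases (b), (c), (d) and the
remaining types of [MZ95] — are not treated in this file.) [cite: MoonenZarhin1999LowDim, Thm. (0.1) (4) (p0001 L96–L122), Introduction (p0001 L62–L80) and §5 (5.2), (5.4)–(5.5) (p0008 L107–L111, p0009 L83–L108)]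
[cite: Gordon1999HodgeAVSurvey, Thm. 7.5] -/
theorem IsRiemannForm.forall_divisorClasses_powPeriod_eq_hodgeClasses_of_finrank_le_four
    (hη : IsRiemannForm Ψ η) (h0 : 0 < finrank ℂ E) (h4 : finrank ℂ E ≤ 4) (hX : finrank ℂ E = 4 → ¬ IsSimple Ψ)
    (ha : ∀ {κ' : Type} [Fintype κ'] [DecidableEq κ'] {E' : Type} [NormedAddCommGroup E'] [NormedSpace ℂ E']
      [FiniteDimensional ℂ E'] {Ψ' : (κ' → ℝ) ≃L[ℝ] E'} {η' : E' [⋀^Fin 2]→L[ℝ] ℝ}, IsRiemannForm Ψ' η' →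
      finrank ℂ E' = 3 → IsSimple Ψ' → ∀ {τ : ℂ} (hτ : τ.im ≠ 0), ellipticEnd hτ ≠ ⊥ →
      IsIsogenous Ψ (prodPeriod Ψ' (ellipticPeriod hτ)) → IsEmpty (Algebra.adjoin ℚ {τ} →ₐ[ℚ] endAlgRat Ψ')) :
    ∀ k p, divisorClasses (powPeriod Ψ k) p = hodgeClasses (powPeriod Ψ k) p := by
  by_cases h : finrank ℂ E = 4
  · exact hη.forall_divisorClasses_powPeriod_eq_hodgeClasses_of_not_isSimple_of_finrank_eq_four h (hX h) ha
  · exact hη.forall_divisorClasses_powPeriod_eq_hodgeClasses_of_finrank_le_three h0 (by omega)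

/-- **… and «`Hg(X) = Sp_D(V,φ)`» up to dimension `4` outside the simple fourfolds and case (a): `Hg(X)(ℝ) = S(X)(ℝ)`.**
[cite: MoonenZarhin1999LowDim, Thm. (0.1) (4) (p0001 L120–L122) and §5 (5.2) (p0008 L107–L111: «for every complex abelian variety `X` of dimension `≤ 3` we have `Hg(X) = Sp_D(V,φ)`»)]
[cite: Gordon1999HodgeAVSurvey, Thm. 7.5 (1) ⟺ (2)] -/
theorem IsRiemannForm.hodgeGroup_eq_lefschetzGroup_of_finrank_le_four
    (hη : IsRiemannForm Ψ η) (h0 : 0 < finrank ℂ E) (h4 : finrank ℂ E ≤ 4) (hX : finrank ℂ E = 4 → ¬ IsSimple Ψ)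
    (ha : ∀ {κ' : Type} [Fintype κ'] [DecidableEq κ'] {E' : Type} [NormedAddCommGroup E'] [NormedSpace ℂ E']
      [FiniteDimensional ℂ E'] {Ψ' : (κ' → ℝ) ≃L[ℝ] E'} {η' : E' [⋀^Fin 2]→L[ℝ] ℝ}, IsRiemannForm Ψ' η' →
      finrank ℂ E' = 3 → IsSimple Ψ' → ∀ {τ : ℂ} (hτ : τ.im ≠ 0), ellipticEnd hτ ≠ ⊥ →
      IsIsogenous Ψ (prodPeriod Ψ' (ellipticPeriod hτ)) → IsEmpty (Algebra.adjoin ℚ {τ} →ₐ[ℚ] endAlgRat Ψ')) :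
    hodgeGroup Ψ = lefschetzGroup Ψ η := by
  obtain ⟨G, hG⟩ := hη.exists_ratMatrix_latticeGram
  exact ((hη.forall_divisorClasses_powPeriod_eq_hodgeClasses_iff_eq_and_hodgeGroup_eq_lefschetzGroup hG h0).1
    (hη.forall_divisorClasses_powPeriod_eq_hodgeClasses_of_finrank_le_four h0 h4 hX ha)).2

end LeFour

end ComplexTorus

end Literature.Geometry.Kaehler
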